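import Summits.BirchSwinnertonDyer.Rank1Residual.P2.CongruentNumberThetaCriterion
import Summits.BirchSwinnertonDyer.Rank1Residual.P2.CongruentNumberThetaStarConfig
import HarnessLib
import HarnessLib.Audit.Tags

/-!
# Cell «bsd-monsky» (prover-B): THE STAR FAMILY — route B's `θ`-criterion decides a family of `n ≡ 6 (mod 8)` with an
# ARBITRARY number of prime factors: `n = 2·q·p₁⋯p_m`, `q ≡ 3`, `pᵢ ≡ 5 (mod 8)` pairwise quadratic residues, at most one `pᵢ` a
# non-residue mod `q` ⟹ `𝓛(n)` odd and `ord_{s=1} L(E_n, s) = 1`, for EVERY `m ≥ 0`, relative to {`tyz_cmPointGaloisData`, TYZ Thm. 1.1}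
# (kernel theorem; nothing asserted, nothing booked)

HONEST FRAMING (cell `bsd-monsky`, run/shared/lean/pub/bsd-monsky/; README §1/§3): the cell's CLAIMED theorem is Monsky's 1990
conjecture on the `k = 2` family `𝒮⁻`; «ℓ ≥ 3 rungs are NOT claimed — record what the same argument gives there, no more». THIS FILE is
that record in its first form UNIFORM IN THE NUMBER OF PRIME FACTORS. g9's uniform Θ-criterion (`P2/CongruentNumberThetaCriterion.lean`,
`ThetaDescent.odd_scriptL_of_thetaCert`) reduces «`𝓛(n)` odd» for square-free `θ`-controlled `n ≡ 6 (mod 8)` to a Θ-certificate, i.e. to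
parities of genus class numbers `g(d) = #2Cl(ℚ(√−d))` and of TYZ's `𝓛` of cofactors; every instance so far (`k = 2, 3, 4`) decided
those parities by `decide` on a bounded symbol pattern. For the STAR TYPE they are available in closed form for every `m`
(`P2/CongruentNumberThetaStarConfig.lean`, `𝔽₂`-linear algebra on Li–Ma's Rédei matrices): with `P = p₁⋯p_m`,
`n = 2qP` is square-free, `≡ 6 (mod 8)` and `θ`-CONTROLLED (every `5`-divisor is a product of the `pᵢ ≡ 1 (mod 4)`; §1); `g(n)` is
ODD and `g(w)` is EVEN for every divisor `w > 1`, `w ≡ 1 (mod 8)` of `P` (§2, Rédei–Reichardt = tree theorem); hence TYZ's `𝓛(w)` is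
EVEN for every such `w` (Thm. 1.1 = `h11`: every decomposition counted in `Σ₁(w)` has a part `≡ 1 (mod 8)`, `> 1`; §3); the `6`-blocks
of `n` are the `2qz`, `z ∣ P`, with cofactors `z/z′ ≡ 1 (mod 8)` inside `R`, so ALL inner coefficients of the certificate equations
vanish and the FLAT certificate `s = g` is valid: `Θ(n) = g(n) = 1` (§4, `thetaCert_star`).
THEOREM B_∞ (`odd_scriptL_star`): for TYZ data with the displayed sentences and rank `≤ 1` once `𝓛 ≠ 0`, `𝓛(n)` is ODD; clause (a)
`ord_{s=1} L(E_n, s) = 1` from {`tyz_cmPointGaloisData`, `thm11_parity_of_scriptL`} ALONE (`analyticRank_eq_one_star_of_cmPointGaloisData`;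
the Legendre-symbol form and clause (b) are in the companion `…ThetaStarBSD.lean`); an odd `L` with `L² = 𝓛(n)²` (+ GZK). Instances:
`m = 0` is `n = 2q` (Monsky 1990); `m = 1` with `(p₁/q) = −1` is THEOREM B on `𝒮⁻ ∩ {q ≡ 3 (mod 8)}` (book230 classes `30`, `174`);
`m = 2`, one mark, is the silent census type `[3,5,5]/(1,0,0),(0,1,0)` (`1830`, `2262`; g9's `…ThetaThreePrimesC`); `m = 3`: `199470 =
2·3·5·61·109`, …. With exactly ONE mark the family is SILENT for Tian–Yuan–Zhang's Thm. 1.2 at every `m` (`Σ₂′ ≡ 0`), with NO mark it is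
loud (`Σ₂′ ≡ 1`) — census statements here (control below); neither sub-family is a case of Tian 2014 Thm. 1.3 / 5.2 (there all primes
but one are `≡ 1 (mod 8)`). CONTROL (never an input): kit job j252342 (PARI; 224 members, `m ≤ 5`, `q ∈ {3, 11, 19, 43}`): `θ`-control,
`Θ = g(n) mod 2`, the predicted `g`-parity of EVERY divisor, `Σ₂′` and Monsky's `s(n) = 1` on 224/224; analytic rank `1` on all 78
members with `n ≤ 1.5·10⁵` and (j252413) on `199470, 419070, 577390, 820990`; 0 alarms (HOME/proof/j252342-star-family-control.log).
CONDITIONAL on the named facts said; nothing asserted; no count moves; no class booked. NOT refereed; not part of PROOF-B v1.3 or of the paper.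

References: [TianYuanZhang2017] Thm. 1.1, §1 (1.1), §3.1 (p0011 L67–L73), Prop. 3.2, Thm. 3.5, Thm. 3.6 (J741), proof of Lemma 3.21
(J759); [LiMa2008] Lemma 0.1, Def. 0.2, Thm. 0.4; [Monsky1990] Math. Z. 204, p. 45 (2p, p ≡ 3 (mod 4)); [IrelandRosen1990] Ch. 5 §2
Thm. 1; [HardyWright2008] §1.3 Thm. 2, §17.8; HOME/proof/PROOF-B-THETA-STAR.md (companion note), HOME/proof/PROOF-B-THETA-CRITERION.md.
-/

noncomputable section

open scoped Classical

open Matrix Finset WeierstrassCurve Literature.NumberTheory.EllipticCurves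
  Literature.NumberTheory.EllipticCurves.Rank1Residual
  Literature.NumberTheory.EllipticCurves.Rank1Residual.Typed
  Literature.NumberTheory.EllipticCurves.HeathBrown1994
  Literature.NumberTheory.EllipticCurves.TianYuanZhang2017
  Literature.NumberTheory.EllipticCurves.TianYuanZhang2017.W2
  Literature.NumberTheory.QuadraticFields.RedeiReichardt

set_option autoImplicit false

namespace Summit.BirchSwinnertonDyer.Rank1Residual.P2

namespace ThetaDescent

variable {m : ℕ} {q : ℕ} {p : Fin m → ℕ}

/-! ## §1 Arithmetic of the star type `n = 2·q·p₁⋯p_m` (`q ≡ 3`, `pᵢ ≡ 5 (mod 8)`) -/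

/-- A divisor of `p₁⋯p_m` (`pᵢ ≡ 5 (mod 8)` distinct primes) is `≡ 1` or `≡ 5 (mod 8)` (it is the product of its prime factors, all
`≡ 5`). [cite: HardyWright2008, §17.8 (square-free numbers), §1.3 Thm. 2] -/
theorem mod_eight_of_dvd_prod_five (hp : ∀ i, (p i).Prime) (hp5 : ∀ i, p i % 8 = 5) (hinj : Function.Injective p)
    {z : ℕ} (hz : z ∣ ∏ i, p i) : z % 8 = 1 ∨ z % 8 = 5 := by
  have hzsq : Squarefree z := (squarefree_prod_of_injective p hp hinj).squarefree_of_dvd hz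
  have hr5 : ∀ r ∈ z.primeFactors, r % 8 = 5 := by
    intro r hr
    have hrp : r.Prime := Nat.prime_of_mem_primeFactors hr
    obtain ⟨i, -, hi⟩ := ((Nat.Prime.prime hrp).dvd_finsetProd_iff p).mp ((Nat.dvd_of_mem_primeFactors hr).trans hz)
    rw [(Nat.prime_dvd_prime_iff_eq hrp (hp i)).mp hi]
    exact hp5 i
  rw [← Nat.prod_primeFactors_of_squarefree hzsq]
  refine Finset.prod_induction _ (fun x => x % 8 = 1 ∨ x % 8 = 5) ?_ (Or.inl rfl) fun r hr => Or.inr (hr5 r hr)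
  rintro a b (ha | ha) (hb | hb) <;> rw [Nat.mul_mod, ha, hb] <;> decide

/-- The prime tuple `(q, p₁, …, p_m)` of the star type: all prime. [cite: HardyWright2008, §1.3 Thm. 2] -/
theorem star_cons_prime (hq : q.Prime) (hp : ∀ i, (p i).Prime) : ∀ i, ((vecCons q p : Fin (m + 1) → ℕ) i).Prime :=
  fun i => Fin.cases (by simpa using hq) (fun j => by simpa using hp j) i

/-- The prime tuple `(q, p₁, …, p_m)` of the star type: all odd. [cite: HardyWright2008, §1.3 Thm. 2] -/
theorem star_cons_odd (hq3 : q % 8 = 3) (hp5 : ∀ i, p i % 8 = 5) : ∀ i, Odd ((vecCons q p : Fin (m + 1) → ℕ) i) :=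
  fun i => Fin.cases (by simpa using Nat.odd_iff.mpr (by omega))
    (fun j => by simpa using Nat.odd_iff.mpr (by have := hp5 j; omega)) i

/-- The prime tuple `(q, p₁, …, p_m)` of the star type is injective (`q ≢ pᵢ (mod 8)`). [cite: HardyWright2008, §1.3 Thm. 2] -/
theorem star_cons_injective (hq3 : q % 8 = 3) (hp5 : ∀ i, p i % 8 = 5) (hinj : Function.Injective p) :
    Function.Injective (vecCons q p : Fin (m + 1) → ℕ) := by
  have h : Function.Injective (Fin.cons q p : Fin (m + 1) → ℕ) := by
    rw [Fin.cons_injective_iff]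
    exact ⟨by rintro ⟨i, hi⟩; have := hp5 i; omega, hinj⟩
  exact h

/-- `∏ (q, p₁, …, p_m) = q · ∏ pᵢ`. [cite: HardyWright2008, §1.3 Thm. 2] -/
theorem prod_star_cons : ∏ i, (vecCons q p : Fin (m + 1) → ℕ) i = q * ∏ i, p i := by
  rw [Fin.prod_univ_succ]
  simp

/-- `n = 2·q·p₁⋯p_m` is square-free. [cite: HardyWright2008, §17.8] -/
theorem squarefree_star (hq : q.Prime) (hq3 : q % 8 = 3) (hp : ∀ i, (p i).Prime) (hp5 : ∀ i, p i % 8 = 5)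
    (hinj : Function.Injective p) : Squarefree (2 * (q * ∏ i, p i)) := by
  rw [← prod_star_cons]
  exact squarefree_two_mul_prod_of_injective _ (star_cons_prime hq hp) (star_cons_odd hq3 hp5)
    (star_cons_injective hq3 hp5 hinj)

/-- `n = 2·q·p₁⋯p_m ≡ 6 (mod 8)` (`qP ≡ 3·1, 3·5 ≡ 3, 7`). [cite: HardyWright2008, §5.2 (residues)] -/
theorem star_mod_eight (hq3 : q % 8 = 3) (hp : ∀ i, (p i).Prime) (hp5 : ∀ i, p i % 8 = 5) (hinj : Function.Injective p) :
    (2 * (q * ∏ i, p i)) % 8 = 6 := by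
  have h : (q * ∏ i, p i) % 8 = 3 ∨ (q * ∏ i, p i) % 8 = 7 := by
    rcases mod_eight_of_dvd_prod_five hp hp5 hinj (dvd_refl _) with h | h <;> rw [Nat.mul_mod, hq3, h] <;> decide
  omega

/-- **The `6`-blocks of the star type are the `2qz`, `z ∣ p₁⋯p_m`** (`z`, `qz`, `2z ≡ 1/5, 3/7, 2 (mod 8)` are not `≡ 6`).
[cite: TianYuanZhang2017, §3.1 (p0011 L67–L70)] -/
theorem six_block_star (hq : q.Prime) (hq3 : q % 8 = 3) (hp : ∀ i, (p i).Prime) (hp5 : ∀ i, p i % 8 = 5)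
    (hinj : Function.Injective p) {e : ℕ} (he : e ∣ 2 * (q * ∏ i, p i)) (he6 : e % 8 = 6) :
    ∃ z : ℕ, z ∣ ∏ i, p i ∧ e = 2 * (q * z) := by
  obtain ⟨y, w, hy, hw, rfl⟩ := Nat.dvd_mul.mp he
  obtain ⟨y', z, hy', hz, rfl⟩ := Nat.dvd_mul.mp hw
  have hz15 := mod_eight_of_dvd_prod_five hp hp5 hinj hz
  have hqz : (q * z) % 8 = 3 ∨ (q * z) % 8 = 7 := by
    rcases hz15 with h | h <;> rw [Nat.mul_mod, hq3, h] <;> decide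
  rcases (Nat.dvd_prime Nat.prime_two).mp hy with rfl | rfl <;>
    rcases (Nat.dvd_prime hq).mp hy' with rfl | rfl
  · exfalso; omega
  · exfalso; omega
  · exfalso; omega
  · exact ⟨z, hz, rfl⟩

/-- **The star type is `θ`-CONTROLLED**: every `5`-divisor `d′` of `n = 2qP` is a product of the `pᵢ ≡ 1 (mod 4)` (`2 ∤ d′`; `q ∣ d′`
would give `d′ = q·e ≡ 3, 7 (mod 8)`). [cite: TianYuanZhang2017, §3.1 (p0011 L67–L70)] -/
theorem thetaControlled_star (hq : q.Prime) (hq3 : q % 8 = 3) (hp : ∀ i, (p i).Prime) (hp5 : ∀ i, p i % 8 = 5)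
    (hinj : Function.Injective p) :
    ∀ d₀ ∈ (2 * (q * ∏ i, p i)).divisors, d₀ % 8 = 7 → (2 * (q * ∏ i, p i) / d₀) % 8 = 2 →
      ∀ d' ∈ d₀.divisors, d' % 8 = 5 → ∀ r ∈ d'.primeFactors, r % 4 = 1 := by
  intro d₀ hd₀ _ _ d' hd' h5 r hr
  have hd'n : d' ∣ 2 * (q * ∏ i, p i) := (Nat.mem_divisors.mp hd').1.trans (Nat.mem_divisors.mp hd₀).1
  obtain ⟨hrp, hrd, -⟩ := Nat.mem_primeFactors.mp hr
  rcases (Nat.Prime.dvd_mul hrp).mp (hrd.trans hd'n) with h2 | hrest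
  · have h22 := (Nat.prime_dvd_prime_iff_eq hrp Nat.prime_two).mp h2
    subst h22
    omega
  rcases (Nat.Prime.dvd_mul hrp).mp hrest with hrq | hrP
  · -- `r = q`: then `d' = q·e` with `e ∣ P`, so `d' ≡ 3, 7 (mod 8)`
    have hr1 : r = q := (Nat.prime_dvd_prime_iff_eq hrp hq).mp hrq
    subst hr1
    obtain ⟨e, he⟩ := hrd
    have he2 : e ∣ 2 * ∏ i, p i := by
      have h' : r * e ∣ r * (2 * ∏ i, p i) := by
        rw [← he, show r * (2 * ∏ i, p i) = 2 * (r * ∏ i, p i) by ring]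
        exact hd'n
      exact Nat.dvd_of_mul_dvd_mul_left hrp.pos h'
    have hd'odd : Odd d' := Nat.odd_iff.mpr (by omega)
    have heodd : Odd e := by rw [he] at hd'odd; exact (Nat.odd_mul.mp hd'odd).2
    have heP : e ∣ ∏ i, p i := (Nat.coprime_two_right.mpr heodd).dvd_of_dvd_mul_left he2
    have : d' % 8 = 3 ∨ d' % 8 = 7 := by
      rw [he]
      rcases mod_eight_of_dvd_prod_five hp hp5 hinj heP with h | h <;> rw [Nat.mul_mod, hq3, h] <;> decide
    omega
  · obtain ⟨i, -, hi⟩ := ((Nat.Prime.prime hrp).dvd_finsetProd_iff p).mp hrP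
    rw [(Nat.prime_dvd_prime_iff_eq hrp (hp i)).mp hi]
    have := hp5 i
    omega

/-! ## §2 The two `g`-parities of the star type, for every `m` (Rédei–Reichardt, a tree theorem, on the star configurations) -/

/-- **`g(w)` is EVEN for every divisor `w > 1`, `w ≡ 1 (mod 8)` of `p₁⋯p_m`** (`pᵢ ≡ 5 (mod 8)` pairwise quadratic residues):
`w` is the product of `s ≥ 2` of the `pᵢ` (it is `> 1` and `≢ 5`), and on that sub-configuration `gBitCfg = 0`
(`gBitCfg_fiveClique_eq_zero`), i.e. `#2Cl(ℚ(√−w))` even by Rédei–Reichardt (`redeiReichardt_fourTwoCard_classGroup_holds`).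
[cite: LiMa2008, Thm. 0.4 (p. 280)] [cite: TianYuanZhang2017, §1 (p0002 L78–L82: g(d))] -/
theorem even_genusClassNumber_of_dvd_prod_five (hp : ∀ i, (p i).Prime) (hp5 : ∀ i, p i % 8 = 5)
    (hinj : Function.Injective p) (hQR : ∀ i j, i ≠ j → kroneckerBit (p j) (p i) = 0)
    {z : ℕ} (hz : z ∣ ∏ i, p i) (h1 : 1 < z) (hz1 : z % 8 = 1) :
    Even (genusClassNumber (GenusField z)) := by
  -- `z` is the product of the `pᵢ` dividing it
  set T : Finset (Fin m) := univ.filter fun i => p i ∣ z with hT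
  have hzT : z = ∏ i ∈ T, p i := by
    apply Nat.dvd_antisymm
    · have hsplit : (∏ i ∈ T, p i) * ∏ i ∈ univ.filter (fun i => ¬ p i ∣ z), p i = ∏ i, p i :=
        Finset.prod_filter_mul_prod_filter_not univ (fun i => p i ∣ z) p
      have hcop : Nat.Coprime z (∏ i ∈ univ.filter (fun i => ¬ p i ∣ z), p i) :=
        Nat.Coprime.prod_right fun i hi =>
          Nat.coprime_comm.mp ((Nat.Prime.coprime_iff_not_dvd (hp i)).mpr (Finset.mem_filter.mp hi).2)
      exact hcop.dvd_of_dvd_mul_right (hsplit.symm ▸ hz)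
    · rw [← Finset.prod_image (s := T) (f := fun r => r) (g := p) fun i _ j _ h => hinj h]
      exact Finset.prod_primes_dvd z
        (fun r hr => by obtain ⟨i, -, rfl⟩ := Finset.mem_image.mp hr; exact (hp i).prime)
        (fun r hr => by obtain ⟨i, hi, rfl⟩ := Finset.mem_image.mp hr; exact (Finset.mem_filter.mp hi).2)
  -- `T` has at least two elements
  have hT2 : 1 < T.card := by
    rcases Nat.lt_or_ge 1 T.card with hlt | hle
    · exact hlt
    exfalso
    interval_cases hc : T.card
    · rw [Finset.card_eq_zero.mp hc, Finset.prod_empty] at hzT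
      omega
    · obtain ⟨i, hi⟩ := Finset.card_eq_one.mp hc
      rw [hi, Finset.prod_singleton] at hzT
      have := hp5 i
      omega
  obtain ⟨i₀, hi₀, i₁, hi₁, hne⟩ := Finset.one_lt_card.mp hT2
  -- enumerate `T` by `Fin T.card`
  set e : Fin T.card → Fin m := fun j => ((T.equivFin.symm j : T) : Fin m) with he
  have he_inj : Function.Injective e := fun a b h => T.equivFin.symm.injective (Subtype.ext h)
  have hprod : ∏ j, p (e j) = z := by
    rw [hzT, ← Finset.prod_coe_sort T]
    exact Fintype.prod_equiv T.equivFin.symm (fun j => p (e j)) (fun x => p x) (fun j => rfl)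
  have key := natCast_genusClassNumber_eq_gBitCfg redeiReichardt_fourTwoCard_classGroup_holds (fun j => p (e j))
    (fun j => hp (e j)) (fun j => by have := hp5 (e j); omega) (hinj.comp he_inj)
  have hcfg : gBitCfg (fun j => p (e j) % 8) (fun a b => kroneckerBit (p (e b)) (p (e a))) = 0 :=
    gBitCfg_fiveClique_eq_zero _ (fun j => hp5 (e j)) _ (fun a b hab => hQR (e a) (e b) fun h => hab (he_inj h))
      (i₀ := T.equivFin ⟨i₀, hi₀⟩) (i₁ := T.equivFin ⟨i₁, hi₁⟩)
      (fun h => hne (congrArg Subtype.val (T.equivFin.injective h)))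
  rw [hprod, hcfg] at key
  exact ZMod.natCast_eq_zero_iff_even.mp key

/-- **`g(n) = g(2·q·p₁⋯p_m)` is ODD on the star type, for every `m ≥ 0`** (at most one `pᵢ` a non-residue mod `q`): the configuration of
`(q, p₁, …, p_m)` is the star configuration (`[(q/pᵢ) = −1] = [(pᵢ/q) = −1]` by reciprocity, `pᵢ ≡ 1 (mod 4)`), on which `gBitCfgTwo = 1`
(`gBitCfgTwo_star_eq_one`), i.e. `#2Cl(ℚ(√−n))` odd by Rédei–Reichardt (`redeiReichardt_fourTwoCard_classGroup_holds`).
[cite: LiMa2008, Thm. 0.4 (p. 280)] [cite: IrelandRosen1990, Ch. 5 §2 Thm. 1] [cite: TianYuanZhang2017, §1 (p0002 L78–L82: g(d))] -/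
theorem odd_gK_star (hq : q.Prime) (hq3 : q % 8 = 3) (hp : ∀ i, (p i).Prime) (hp5 : ∀ i, p i % 8 = 5)
    (hinj : Function.Injective p) (hQR : ∀ i j, i ≠ j → kroneckerBit (p j) (p i) = 0)
    (hμ : ∀ i j, kroneckerBit (p i) q = 1 → kroneckerBit (p j) q = 1 → i = j) :
    Odd (gK (2 * (q * ∏ i, p i))) := by
  have hq2 : q ≠ 2 := by omega
  have hq4 : q % 4 = 3 := by omega
  have hP2 : ∀ i, (vecCons q p : Fin (m + 1) → ℕ) i ≠ 2 := fun i h2 => by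
    have h := star_cons_odd (q := q) hq3 hp5 i
    rw [h2] at h
    exact (Nat.not_odd_iff_even.mpr even_two) h
  have key := natCast_genusClassNumber_two_mul_eq_gBitCfgTwo redeiReichardt_fourTwoCard_classGroup_holds
    (vecCons q p : Fin (m + 1) → ℕ) (star_cons_prime hq hp) hP2 (star_cons_injective hq3 hp5 hinj)
  rw [prod_star_cons] at key
  have hcfg : gBitCfgTwo (fun i => (vecCons q p : Fin (m + 1) → ℕ) i % 8)
      (fun a b => kroneckerBit ((vecCons q p : Fin (m + 1) → ℕ) b) ((vecCons q p : Fin (m + 1) → ℕ) a)) = 1 := by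
    refine gBitCfgTwo_star_eq_one _ ?_ ?_ _ (fun i => kroneckerBit (p i) q) ?_ ?_ ?_ hμ
    · simp [hq3]
    · intro i; simp [hp5 i]
    · intro i; simp
    · intro i
      have hpi2 : p i ≠ 2 := by have := hp5 i; omega
      have hpi4 : p i % 4 = 1 := by have := hp5 i; omega
      have hne : q ≠ p i := fun h => by have := hp5 i; omega
      simp only [cons_val_succ, cons_val_zero]
      rw [kroneckerBit_swap hq (hp i) hq2 hpi2 hne]
      simp [chi4Bit, hq4, hpi4]
    · intro i j hij
      simp only [cons_val_succ]
      exact hQR i j hij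
  rw [hcfg] at key
  unfold gK
  exact ZMod.natCast_eq_one_iff_odd.mp key

/-! ## §3 TYZ's `𝓛(w)` is EVEN for every even block `w` (Thm. 1.1 + §2) -/

/-- **`𝓛(w)` is EVEN, for ANY sign choice, for every divisor `w > 1`, `w ≡ 1 (mod 8)` of `p₁⋯p_m`** (`pᵢ ≡ 5 (mod 8)` pairwise
residues): by TYZ Thm. 1.1 (`h11`) `𝓛(w) ≡ Σ₁(w) (mod 2)`, and every decomposition of `w` counted in `Σ₁(w)` — at most one part
`≢ 1 (mod 8)`, the parts being `≡ 1, 5` — has a part `≡ 1 (mod 8)`, `> 1` (else it is `{w}` with `w ≡ 5`), whose `g` is even (§2).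
CONDITIONAL on `h11`. [cite: TianYuanZhang2017, Thm. 1.1 (p0002 L90–L99)] -/
theorem even_of_isScriptL_dvd_prod_five (h11 : thm11_parity_of_scriptL) (hp : ∀ i, (p i).Prime) (hp5 : ∀ i, p i % 8 = 5)
    (hinj : Function.Injective p) (hQR : ∀ i j, i ≠ j → kroneckerBit (p j) (p i) = 0)
    {w : ℕ} (hw : w ∣ ∏ i, p i) (h1 : 1 < w) (hw1 : w % 8 = 1) {L : ℤ} (hL : IsScriptL w L) : Even L := by
  have hsq : Squarefree w := (squarefree_prod_of_injective p hp hinj).squarefree_of_dvd hw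
  obtain ⟨L', hL', hpar⟩ := h11 w hsq (Or.inl hw1) GenusField (isGenusFieldFamily_genusField _)
  have hsum : ((genusSum₁ w fun d => genusClassNumber (GenusField d) : ℕ) : ZMod 2) = 0 := by
    unfold genusSum₁
    rw [Nat.cast_sum]
    refine Finset.sum_eq_zero fun D hD => ?_
    obtain ⟨hDdec, hDfil⟩ := Finset.mem_filter.mp hD
    have hparts : ∀ d ∈ D, d ∣ w ∧ 1 < d := by
      intro d hd
      have h := hDdec
      simp only [decompositions, Finset.mem_filter, Finset.mem_powerset] at h
      exact ⟨Nat.dvd_of_mem_divisors (h.1 hd), h.2.1 d hd⟩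
    have hDne : D.Nonempty := by
      rw [Finset.nonempty_iff_ne_empty]
      rintro rfl
      have h := hDdec
      simp only [decompositions, Finset.mem_filter, Finset.prod_empty] at h
      omega
    -- a part `≡ 1 (mod 8)`
    obtain ⟨d, hd, hd1⟩ : ∃ d ∈ D, d % 8 = 1 := by
      by_cases hex : ∃ d ∈ D, d % 8 = 1
      · exact hex
      exfalso
      have hno : ∀ d ∈ D, d % 8 ≠ 1 := fun d hd h => hex ⟨d, hd, h⟩
      have hall : D.filter (fun d => d % 8 ≠ 1) = D := Finset.filter_true_of_mem hno
      rw [hall] at hDfil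
      obtain ⟨d, hd⟩ := hDne
      have huniq : ∀ x ∈ D, x = d := fun x hx => Finset.card_le_one.mp hDfil x hx d hd
      have hDw : D = {w} := eq_singleton_of_mem_decompositions hDdec hd huniq
      have hdw : d = w := by rw [hDw] at hd; exact Finset.mem_singleton.mp hd
      exact hno d hd (hdw ▸ hw1)
    obtain ⟨hdw, hd1'⟩ := hparts d hd
    have heven : Even (genusClassNumber (GenusField d)) :=
      even_genusClassNumber_of_dvd_prod_five hp hp5 hinj hQR (hdw.trans hw) hd1' hd1
    rw [ZMod.natCast_eq_zero_iff_even]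
    exact even_iff_two_dvd.mpr ((even_iff_two_dvd.mp heven).trans (Finset.dvd_prod_of_mem _ hd))
  rw [hsum] at hpar
  have hL'even : Even L' := ZMod.intCast_eq_zero_iff_even.mp hpar
  have hsq' : L ^ 2 = L' ^ 2 := by
    have h : ((L : ℂ)) ^ 2 = ((L' : ℂ)) ^ 2 := by rw [hL, hL']
    exact_mod_cast h
  rcases sq_eq_sq_iff_eq_or_eq_neg.mp hsq' with h | h
  · rw [h]; exact hL'even
  · rw [h]; exact hL'even.neg

/-! ## §4 The FLAT Θ-certificate `s = g` and THEOREM B_∞ -/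

/-- **The flat Θ-certificate of the star type.** For every `6`-block `e = 2qz ∣ n` and every `6`-block `d₀ = 2qz′ ∈ R(e)` the cofactor
`e/d₀ = z/z′` is a divisor `> 1`, `≡ 1 (mod 8)` of `p₁⋯p_m`, so `𝓛(e/d₀)` is even (§3): the certificate equations
`s(e) = g(e) + Σ_{d₀} 𝓛(e/d₀)s(d₀)` hold with `s = g (mod 2)` — `Θ(n) = g(n)`, whatever the Θ-depth. CONDITIONAL on `h11`.
[cite: TianYuanZhang2017, §3.1 (p0011 L67–L73), Thm. 1.1] -/
theorem thetaCert_star (h11 : thm11_parity_of_scriptL) (hq : q.Prime) (hq3 : q % 8 = 3) (hp : ∀ i, (p i).Prime)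
    (hp5 : ∀ i, p i % 8 = 5) (hinj : Function.Injective p) (hQR : ∀ i j, i ≠ j → kroneckerBit (p j) (p i) = 0)
    (D : GenusPointData (2 * (q * ∏ i, p i))) (hL : D.scriptLSpec) :
    ∀ e ∈ (2 * (q * ∏ i, p i)).divisors, e % 8 = 6 → (2 * (q * ∏ i, p i) / e) % 8 = 1 →
      (fun e => (gK e : ZMod 2)) e = (gK e : ZMod 2) +
        ∑ d₀ ∈ (recursionIndex e).filter (fun d₀ => d₀ % 8 = 6),
          (D.scriptL (e / d₀) : ZMod 2) * (fun e => (gK e : ZMod 2)) d₀ := by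
  have hsq := squarefree_star hq hq3 hp hp5 hinj
  intro e he he6 _
  suffices h : ∑ d₀ ∈ (recursionIndex e).filter (fun d₀ => d₀ % 8 = 6),
      (D.scriptL (e / d₀) : ZMod 2) * (gK d₀ : ZMod 2) = 0 by
    simp only [h, add_zero]
  refine Finset.sum_eq_zero fun d₀ hd₀ => ?_
  obtain ⟨hd₀R, hd₀6⟩ := Finset.mem_filter.mp hd₀
  obtain ⟨hd₀e, -, h123, hgt⟩ := mem_recursionIndex_iff.mp hd₀R
  have hen : e ∣ 2 * (q * ∏ i, p i) := Nat.dvd_of_mem_divisors he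
  have hd₀dvd : d₀ ∣ e := Nat.dvd_of_mem_divisors hd₀e
  obtain ⟨z, hz, rfl⟩ := six_block_star hq hq3 hp hp5 hinj hen he6
  obtain ⟨z', hz', rfl⟩ := six_block_star hq hq3 hp hp5 hinj (hd₀dvd.trans hen) hd₀6
  have hqpos : 0 < 2 * q := by have := hq.pos; omega
  have hzz : z' ∣ z := by
    have h : 2 * q * z' ∣ 2 * q * z := by simpa only [mul_assoc] using hd₀dvd
    exact Nat.dvd_of_mul_dvd_mul_left hqpos h
  have hquot : 2 * (q * z) / (2 * (q * z')) = z / z' := by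
    rw [show 2 * (q * z) = (2 * q) * z by ring, show 2 * (q * z') = (2 * q) * z' by ring]
    exact Nat.mul_div_mul_left z z' hqpos
  rw [hquot] at h123 hgt ⊢
  have hw : z / z' ∣ ∏ i, p i := (Nat.div_dvd_of_dvd hzz).trans hz
  have hw1 : (z / z') % 8 = 1 := by
    rcases mod_eight_of_dvd_prod_five hp hp5 hinj hw with h | h <;> omega
  have hwn : z / z' ∈ (2 * (q * ∏ i, p i)).divisors :=
    Nat.mem_divisors.mpr ⟨hw.trans ((dvd_mul_left _ q).trans (dvd_mul_left _ 2)), hsq.ne_zero⟩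
  have hev := even_of_isScriptL_dvd_prod_five h11 hp hp5 hinj hQR hw hgt hw1 (hL _ hwn hgt)
  rw [(ZMod.intCast_eq_zero_iff_even (n := D.scriptL (z / z'))).mpr hev, zero_mul]

/-- **THEOREM B_∞ (route B, uniform in the number of prime factors).** Let `q ≡ 3 (mod 8)` and `p₁, …, p_m ≡ 5 (mod 8)` (`m ≥ 0`) be
distinct primes with `(pⱼ/pᵢ) = +1` for all `i ≠ j` and `(pᵢ/q) = −1` for AT MOST ONE `i`; `n = 2·q·p₁⋯p_m`. For every TYZ datum `D` with
the displayed printed sentences (`Printed`, `CMPointGaloisPrinted` — what `tyz_cmPointGaloisData` provides) and rank `E_n(ℚ) ≤ 1` once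
`𝓛(n) ≠ 0`: `𝓛(n)` is ODD. (The uniform Θ-criterion with the flat certificate `Θ = g` and `g(n)` odd.) At `m = 1` with `(p₁/q) = −1` this
is THEOREM B on `𝒮⁻ ∩ {q ≡ 3 (mod 8)}`; at `m = 0` it is `n = 2q`. CONDITIONAL on `h11` and the display; nothing asserted; NOT refereed.
[cite: TianYuanZhang2017, Thm. 3.5 (p0011 L94–L112), Thm. 3.6 (2) (J741), §3.1 (p0011 L67–L73), proof of Lemma 3.21 (J759), Thm. 1.1]
[cite: LiMa2008, Thm. 0.4] -/
theorem odd_scriptL_star (h11 : thm11_parity_of_scriptL) (hq : q.Prime) (hq3 : q % 8 = 3) (hp : ∀ i, (p i).Prime)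
    (hp5 : ∀ i, p i % 8 = 5) (hinj : Function.Injective p) (hQR : ∀ i j, i ≠ j → kroneckerBit (p j) (p i) = 0)
    (hμ : ∀ i j, kroneckerBit (p i) q = 1 → kroneckerBit (p j) q = 1 → i = j)
    (D : GenusPointData (2 * (q * ∏ i, p i))) (hD : D.Printed) (hG : D.CMPointGaloisPrinted)
    (hr :
      letI := isElliptic_congruentNumberCurve (squarefree_star hq hq3 hp hp5 hinj).ne_zero
      D.scriptL (2 * (q * ∏ i, p i)) ≠ 0 → (congruentNumberCurve (2 * (q * ∏ i, p i))).mordellWeilRank ≤ 1) :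
    Odd (D.scriptL (2 * (q * ∏ i, p i))) :=
  odd_scriptL_of_thetaCert (squarefree_star hq hq3 hp hp5 hinj) (star_mod_eight hq3 hp hp5 hinj) D hD hG hr
    (thetaControlled_star hq hq3 hp hp5 hinj) (fun e => (gK e : ZMod 2)) (thetaCert_star h11 hq hq3 hp hp5 hinj hQR D hD.1)
    (ZMod.natCast_eq_one_iff_odd.mpr (odd_gK_star hq hq3 hp hp5 hinj hQR hμ))

/-- **Clause (a) on the star family, from the Literature display ALONE** (+ TYZ Thm. 1.1): `ord_{s=1} L(E_n, s) = 1` for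
`n = 2·q·p₁⋯p_m` as in THEOREM B_∞, for every `m ≥ 0`. No GZK, no Selmer input, no genus-sum hypothesis. CONDITIONAL on
{`tyz_cmPointGaloisData`, `thm11_parity_of_scriptL`}; nothing asserted. [cite: TianYuanZhang2017, §1 (definition of 𝓛(n), p0002 L46–L75), Thm. 1.1, §3] -/
theorem analyticRank_eq_one_star_of_cmPointGaloisData (hCM : tyz_cmPointGaloisData) (h11 : thm11_parity_of_scriptL)
    (hq : q.Prime) (hq3 : q % 8 = 3) (hp : ∀ i, (p i).Prime) (hp5 : ∀ i, p i % 8 = 5) (hinj : Function.Injective p)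
    (hQR : ∀ i j, i ≠ j → kroneckerBit (p j) (p i) = 0) (hμ : ∀ i j, kroneckerBit (p i) q = 1 → kroneckerBit (p j) q = 1 → i = j) :
    (congruentNumberCurve (2 * (q * ∏ i, p i))).analyticRank = 1 :=
  analyticRank_eq_one_of_thetaCert_of_cmPointGaloisData hCM (squarefree_star hq hq3 hp hp5 hinj) (star_mod_eight hq3 hp hp5 hinj)
    (thetaControlled_star hq hq3 hp hp5 hinj) fun D hD _ =>
      ⟨fun e => (gK e : ZMod 2), thetaCert_star h11 hq hq3 hp hp5 hinj hQR D hD.1,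
        ZMod.natCast_eq_one_iff_odd.mpr (odd_gK_star hq hq3 hp hp5 hinj hQR hμ)⟩

/-- **Output shape on the star family**: an ODD integer `L` with `L² = 𝓛(n)²`, relative to {`tyz_cmPointGaloisData`, GZK, TYZ Thm. 1.1}.
CONDITIONAL; nothing asserted. [cite: TianYuanZhang2017, Thm. 3.5 and §3] -/
theorem exists_odd_isScriptL_star_of_cmPointGaloisData (hCM : tyz_cmPointGaloisData)
    (hGZK : rank_eq_analyticRank_of_analyticRank_le_one) (h11 : thm11_parity_of_scriptL)
    (hq : q.Prime) (hq3 : q % 8 = 3) (hp : ∀ i, (p i).Prime) (hp5 : ∀ i, p i % 8 = 5) (hinj : Function.Injective p)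
    (hQR : ∀ i j, i ≠ j → kroneckerBit (p j) (p i) = 0) (hμ : ∀ i j, kroneckerBit (p i) q = 1 → kroneckerBit (p j) q = 1 → i = j) :
    ∃ L : ℤ, Odd L ∧ IsScriptL (2 * (q * ∏ i, p i)) L :=
  exists_odd_isScriptL_of_thetaCert_of_cmPointGaloisData hCM hGZK (squarefree_star hq hq3 hp hp5 hinj)
    (star_mod_eight hq3 hp hp5 hinj) (thetaControlled_star hq hq3 hp hp5 hinj) fun D hD _ =>
      ⟨fun e => (gK e : ZMod 2), thetaCert_star h11 hq hq3 hp hp5 hinj hQR D hD.1,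
        ZMod.natCast_eq_one_iff_odd.mpr (odd_gK_star hq hq3 hp hp5 hinj hQR hμ)⟩

end ThetaDescent

end Summit.BirchSwinnertonDyer.Rank1Residual.P2

end
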